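import Summits.Ventures.CertifiedManyBodySolver.Downfold.EmeryFermiEnergyExistsAll
import Summits.Ventures.CertifiedManyBodySolver.Downfold.EmeryFermiScalePointsLa214Corners
import Summits.Ventures.CertifiedManyBodySolver.Downfold.EmeryBoxesCuprates
import HarnessLib

/-!
# THE FERMI-ENERGY WINDOW OF THE WHOLE TYPED La₂CuO₄ 3BE BOX FROM TWO POINT CERTIFICATES (two-corner rule, §B.83 (i)–(k))

Venture CertifiedManyBodySolver, cell `pub/hubbard-downfold` (stage S1; INFLATION-RULES-3to1-B §B.83 (k)), seat hubbard-downfold-mod-4 (technique B, g34);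
namespace `Summit.Ventures.CertifiedManyBodySolver.Downfold.Emery`. Everything PROVED (0 sorry). WHAT THIS IS NOT: a statement about La₂CuO₄ — the box
`emeryBoxLa214` (box #18, router/BOXES/La2CuO4-family.md «THREE-BAND (3BE) COMPANION BOX») is SCREENING-GRADE; `U = 0` one-body kinematics of the σ model.

For EVERY one-body row `(Δ, t_pd, t_pp, t_pp′) ∈ [1.7, 4] × [1.29, 1.52] × [0.46, 0.66] × [0.12, 0.15]` eV the Fermi energy (above `ε_d`) of the σ antibonding band
satisfies, by `fermiEnergyOf_mem_Icc_of_mem_box'` (the four signed levers: Δ ↓, t_pd ↑, t_pp ↑, t_pp′ ↓) and the two corner brackets of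
`EmeryFermiScalePointsLa214Corners`:

| filling (LSCO column) | low corner (4, 1.29, 0.46, 0.15) | high corner (1.7, 1.52, 0.66, 0.12) | **box window** | g19 sub-box device (EMERY-FS-WINDOWS) |
|---|---|---|---|---|
| x = 0 (ν = 1/2; M13) | [1.2489, 1.2589] | [2.4200, 2.4350] | **[1.2489, 2.4350]** | [1.14, 2.62] |
| x = 1/8 (ν = 7/16; M15 centre) | [1.1653, 1.1753] | [2.2466, 2.2616] | **[1.1653, 2.2616]** | [1.08, 2.48] |
| x = 0.22 (ν = 39/100; M17 centre) | [1.1180, 1.1280] | [2.1467, 2.1567] | **[1.1180, 2.1567]** | — |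

The two-corner windows are the EXACT range of `ε_F` over the box up to the ±0.005 eV corner brackets (the levers are monotone, the corners are members),
≈ 20 % narrower than the sub-box × energy-piece device of §B.15–§B.17 at two `pointBracketCheck`s instead of a box certificate.

Sources: three-band model [HybertsenSchluterChristensen1989, Eq. (1)]; [AndersenEtAl1995, §6]; box rows as cited in `EmeryBoxesCuprates`.
-/

noncomputable section

namespace Summit.Ventures.CertifiedManyBodySolver.Downfold.Emery

open Real Set

/-- **x = 0: every row of the La₂CuO₄ 3BE box has `ε_F ∈ [1.2489, 2.4350]` eV above `ε_d`.** [folklore] -/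
theorem la214Box_fermiEnergyOf_x0 {Δ a b c : ℝ} (hΔ : Δ ∈ Icc (17/10 : ℝ) 4) (ha : a ∈ Icc (129/100 : ℝ) (38/25)) (hb : b ∈ Icc (23/50 : ℝ) (33/50))
    (hc : c ∈ Icc (3/25 : ℝ) (3/20)) : fermiEnergyOf Δ a b c (1/2) ∈ Icc (12489/10000 : ℝ) (487/200) := by
  have hbox := fermiEnergyOf_mem_Icc_of_mem_box' (ν := 1/2) (by norm_num) (by norm_num) (by norm_num) (by norm_num) hΔ ha hb hc
    (by norm_num) (by norm_num)
  have hlo := (fermiEnergyOf_of_pointBracketCheck cornerPt_la214BoxLo_x0_br (by norm_num) (by norm_num) (by norm_num)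
    (ν := (1/2 : ℝ)) (by push_cast; exact ⟨le_rfl, le_rfl⟩)).2
  have hhi := (fermiEnergyOf_of_pointBracketCheck cornerPt_la214BoxHi_x0_br (by norm_num) (by norm_num) (by norm_num)
    (ν := (1/2 : ℝ)) (by push_cast; exact ⟨le_rfl, le_rfl⟩)).2
  push_cast at hlo hhi
  norm_num at hbox hlo hhi ⊢
  exact ⟨by linarith [hbox.1, hlo.1], by linarith [hbox.2, hhi.2]⟩

/-- **x = 1/8: `ε_F ∈ [1.1653, 2.2616]` eV over the box.** [folklore] -/
theorem la214Box_fermiEnergyOf_x0125 {Δ a b c : ℝ} (hΔ : Δ ∈ Icc (17/10 : ℝ) 4) (ha : a ∈ Icc (129/100 : ℝ) (38/25)) (hb : b ∈ Icc (23/50 : ℝ) (33/50))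
    (hc : c ∈ Icc (3/25 : ℝ) (3/20)) : fermiEnergyOf Δ a b c (7/16) ∈ Icc (11653/10000 : ℝ) (2827/1250) := by
  have hbox := fermiEnergyOf_mem_Icc_of_mem_box' (ν := 7/16) (by norm_num) (by norm_num) (by norm_num) (by norm_num) hΔ ha hb hc
    (by norm_num) (by norm_num)
  have hlo := (fermiEnergyOf_of_pointBracketCheck cornerPt_la214BoxLo_x0125_br (by norm_num) (by norm_num) (by norm_num)
    (ν := (7/16 : ℝ)) (by push_cast; exact ⟨le_rfl, le_rfl⟩)).2
  have hhi := (fermiEnergyOf_of_pointBracketCheck cornerPt_la214BoxHi_x0125_br (by norm_num) (by norm_num) (by norm_num)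
    (ν := (7/16 : ℝ)) (by push_cast; exact ⟨le_rfl, le_rfl⟩)).2
  push_cast at hlo hhi
  norm_num at hbox hlo hhi ⊢
  exact ⟨by linarith [hbox.1, hlo.1], by linarith [hbox.2, hhi.2]⟩

/-- **x = 0.22: `ε_F ∈ [1.1180, 2.1567]` eV over the box.** [folklore] -/
theorem la214Box_fermiEnergyOf_x022 {Δ a b c : ℝ} (hΔ : Δ ∈ Icc (17/10 : ℝ) 4) (ha : a ∈ Icc (129/100 : ℝ) (38/25)) (hb : b ∈ Icc (23/50 : ℝ) (33/50))
    (hc : c ∈ Icc (3/25 : ℝ) (3/20)) : fermiEnergyOf Δ a b c (39/100) ∈ Icc (559/500 : ℝ) (21567/10000) := by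
  have hbox := fermiEnergyOf_mem_Icc_of_mem_box' (ν := 39/100) (by norm_num) (by norm_num) (by norm_num) (by norm_num) hΔ ha hb hc
    (by norm_num) (by norm_num)
  have hlo := (fermiEnergyOf_of_pointBracketCheck cornerPt_la214BoxLo_x022_br (by norm_num) (by norm_num) (by norm_num)
    (ν := (39/100 : ℝ)) (by push_cast; exact ⟨le_rfl, le_rfl⟩)).2
  have hhi := (fermiEnergyOf_of_pointBracketCheck cornerPt_la214BoxHi_x022_br (by norm_num) (by norm_num) (by norm_num)
    (ν := (39/100 : ℝ)) (by push_cast; exact ⟨le_rfl, le_rfl⟩)).2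
  push_cast at hlo hhi
  norm_num at hbox hlo hhi ⊢
  exact ⟨by linarith [hbox.1, hlo.1], by linarith [hbox.2, hhi.2]⟩

/-- **Box form (M13, x = 0): for every member `p` of the typed box `emeryBoxLa214` the σ-row Fermi energy at half filling per spin lies in
`[1.2489, 2.4350]` eV** — and it IS the Fermi energy: `abFilling … (fermiEnergyOf … (1/2)) = 1/2`. [folklore] -/
theorem emeryBoxLa214_fermiEnergyOf (p : EmeryCoord → ℝ) (hp : emeryBoxLa214.Mem p) :
    fermiEnergyOf (p .DeltaPd) (p .tpd) (p .tpp) (p .tppP) (1/2) ∈ Icc (12489/10000 : ℝ) (487/200) ∧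
    abFilling (p .DeltaPd) (p .tpd) (p .tpp) (p .tppP) (fermiEnergyOf (p .DeltaPd) (p .tpd) (p .tpp) (p .tppP) (1/2)) = 1/2 := by
  have h := (emeryBoxLa214_mem_iff p).1 hp
  push_cast at h
  obtain ⟨h1, h2, h3, h4, h5, h6, h7, h8, -⟩ := h
  refine ⟨la214Box_fermiEnergyOf_x0 ⟨by linarith, by linarith⟩ ⟨by linarith, by linarith⟩ ⟨by linarith, by linarith⟩ ⟨by linarith, by linarith⟩, ?_⟩
  exact abFilling_fermiEnergyOf' (by linarith) (by intro h0; rw [h0] at h3; linarith) (by linarith) (by linarith) (by norm_num) (by norm_num)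

end Summit.Ventures.CertifiedManyBodySolver.Downfold.Emery
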